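import Mathlib
import Literature.Probability.Percolation.OrbitLoopSides
import Literature.Probability.Percolation.OrbitLoopPieces
import Literature.Probability.Percolation.OrbitLoopDarts
import Literature.Probability.Percolation.LoopTraversalBound
import Literature.Probability.Percolation.AltFourArmLiminfFromLoops
import HarnessLib

/-!
# (H1) for bond-`ℤ²` interface loops, brick 1: from the medial polygon to the rounded Jordan loop

Crux `Summit.CriticalPhenomena.CardyFormulaZ2.Theses.CardyMagicRigidity.NestingRigidity`
(stmt-CriticalPhenomena-4835), line `positive-cone-weight-doubling`, stub `bond_loop_traversalBound`
(Aizenman–Burchard's hypothesis H1 for the system of all interface loops of critical bond percolation on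
`δℤ²`).  The medial polygon `polyline ((γ ++ γ.take 1).map (medialPoint δ))` of an interface loop `γ`
(`IsInterfaceLoop`) touches itself at doubly visited medial vertices; the planar topology of the
multiple-traversal argument is run instead on the ROUNDED loop `OrbitPolygon.loop β p δ` of the orbit of the
first corner `p` of `γ` (`OrbitLoopPolygon.lean`: a Jordan loop; `OrbitLoopCloseness.lean`: `4δ`-close to the
uniformly parametrised medial polygon at equal times).  This brick transfers traversal counts to the rounded
loop (`BondLoopH1.hasTraversals_roundedCurve`: `k` traversals of `D(x; ρ, R)` by the medial polygon give `k`
traversals of `D(x; ρ + 5δ, R - 5δ)` by the rounded loop — reparametrisation invariance and stability of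
`Curve.HasTraversals`), and sets up the timing of the rounded loop read on `[0, 1]`
(local notation `RC[β, p, δ]`; no definition is introduced): the current dart `⌊Q t⌋` (`Q` the period;
local notation `uIdx[Q, t]`), monotone, every
intermediate dart is current at an intermediate time, the loop is within `3δ` of the vertex of its current
dart, it is injective before time `1`, and a point of the `m`-th dart piece is the value at a time of the
first half of the `m`-th slot.  Registered anchor: `bondLoopH1_hasTraversals_roundedLoop`.
-/

noncomputable section

open MeasureTheory Set Filter Metric TopologicalSpace Function
open scoped Topology ENNReal NNReal unitInterval

namespace Summit.CriticalPhenomena.CardyFormulaZ2.Cruxes.NestingRigidity.PositiveConeWeightDoubling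

open Literature.Probability.RandomPlanarGeometry Literature.Probability.Percolation
  Literature.Probability.LatticeModels

/-! Local notations (no definitions are introduced): the rounded Jordan loop of the orbit of the corner `p`
of `β` at mesh `δ`, read on `[0, 1]`, and the index `⌊Q t⌋` of the current dart at time `t`. -/
local notation3 "RC[" β ", " p ", " δ "]" =>
  (Curve.ofPeriodic (OrbitPolygon.loop β p δ) OrbitPolygon.continuous_loop : Curve ℂ)
local notation3 "uIdx[" Q ", " t "]" => ⌊(Q : ℝ) * ((t : unitInterval) : ℝ)⌋₊

namespace BondLoopH1

/-! ### The medial polygon and the uniformly parametrised closed polygon have the same class -/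

/-- The medial polygon of the loop representation (`polyline` through `γ ++ γ.take 1`) and the uniformly
parametrised closed polygon `closedCurve` through the same midpoints have the same curve class.
[folklore] -/
theorem mk_polyline_eq_mk_closedCurve (δ : ℝ) (γ : List MedialVertex) :
    CurveClass.mk (⟨polyline ((γ ++ γ.take 1).map (medialPoint δ))⟩ : Curve ℂ) =
      CurveClass.mk (closedCurve (γ.map (medialPoint δ))) := by
  rw [← closedPolygon_eq_mk_closedCurve, closedPolygon, List.map_append, List.map_take]

/-! ### The rounded loop as a curve on `[0, 1]` -/

/-- Pointwise, the rounded curve `RC[β, p, δ]` (the rounded loop read on `[0, 1]`) is the rounded loop.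
[folklore] -/
theorem roundedCurve_apply (β : BondConfig (Site 2)) (p : Site 2 × Fin 4) (δ : ℝ) (t : I) :
    RC[β, p, δ] t = OrbitPolygon.loop β p δ t := rfl

/-- **Transfer of traversal counts to the rounded loop.** If the medial polygon of the interface loop
`γ` of `β` at mesh `δ` traverses `D(x; ρ, R)` by `k` separate segments, then the rounded loop of the orbit of
the first corner `p` of `γ` traverses `D(x; ρ + 5δ, R - 5δ)` by `k` separate segments: the medial polygon is
a reparametrisation of the uniform closed polygon (distance `0`), which is `4δ`-close to the rounded loop
at equal times. [cite: AizenmanBurchardDuke1999, §1 (1.3)] -/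
theorem hasTraversals_roundedCurve {β : BondConfig (Site 2)} {γ : List MedialVertex}
    (h : IsInterfaceLoop β γ) {p : Site 2 × Fin 4}
    (hps : cSrc p = γ[0 % γ.length]'(Nat.mod_lt _ h.length_pos))
    (hpt : cTgt p = γ[(0 + 1) % γ.length]'(Nat.mod_lt _ h.length_pos)) {δ : ℝ} (hδ : 0 < δ)
    {k : ℕ} {x : ℂ} {ρ R : ℝ}
    (htr : (⟨polyline ((γ ++ γ.take 1).map (medialPoint δ))⟩ : Curve ℂ).HasTraversals k x ρ R) :
    RC[β, p, δ].HasTraversals k x (ρ + 5 * δ) (R - 5 * δ) := by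
  have hd : dist (⟨polyline ((γ ++ γ.take 1).map (medialPoint δ))⟩ : Curve ℂ)
      (closedCurve (γ.map (medialPoint δ))) = 0 :=
    CurveClass.mk_eq_mk_iff_dist_eq_zero.1 (mk_polyline_eq_mk_closedCurve δ γ)
  have h1 : (closedCurve (γ.map (medialPoint δ))).HasTraversals k x (ρ + δ) (R - δ) :=
    htr.of_dist_lt (by rw [hd]; exact hδ)
  have h2 : dist (closedCurve (γ.map (medialPoint δ))).toContinuousMap
      RC[β, p, δ].toContinuousMap ≤ 4 * δ := by
    refine (ContinuousMap.dist_le (by positivity)).2 fun t ↦ ?_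
    exact h.dist_closedCurve_loop_le hps hpt hδ.le t
  have h3 := h1.of_dist_toContinuousMap_le h2
  have e1 : ρ + δ + 4 * δ = ρ + 5 * δ := by ring
  have e2 : R - δ - 4 * δ = R - 5 * δ := by ring
  rw [e1, e2] at h3
  exact h3

/-! ### Timing: the current dart -/

/-- The current dart index `uIdx[Q, t] = ⌊Q t⌋` is monotone in time. [folklore] -/
theorem uIdx_mono (Q : ℕ) {s t : I} (h : s ≤ t) : uIdx[Q, s] ≤ uIdx[Q, t] :=
  Nat.floor_le_floor (mul_le_mul_of_nonneg_left (show (s : ℝ) ≤ t from h) (Nat.cast_nonneg Q))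

/-- Before time `1` the current dart index is `< Q`. [folklore] -/
theorem uIdx_lt {Q : ℕ} (hQ : 0 < Q) {t : I} (ht : (t : ℝ) < 1) : uIdx[Q, t] < Q := by
  have hQ' : (0 : ℝ) < Q := by exact_mod_cast hQ
  refine (Nat.floor_lt (by have := t.2.1; positivity)).2 ?_
  calc (Q : ℝ) * t < Q * 1 := mul_lt_mul_of_pos_left ht hQ'
    _ = Q := mul_one _

/-- The current dart index is `≤ Q`. [folklore] -/
theorem uIdx_le (Q : ℕ) (t : I) : uIdx[Q, t] ≤ Q := by
  refine Nat.le_of_lt_succ ((Nat.floor_lt (by have := t.2.1; positivity)).2 ?_)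
  have := t.2.2
  have hQ : (0 : ℝ) ≤ Q := Nat.cast_nonneg Q
  push_cast
  nlinarith

/-- If the current dart at time `s` comes before dart `k`, then `s < k / Q`. [folklore] -/
theorem lt_div_of_uIdx_lt {Q : ℕ} (hQ : 0 < Q) {s : I} {k : ℕ} (h : uIdx[Q, s] < k) : (s : ℝ) < k / Q := by
  have hQ' : (0 : ℝ) < Q := by exact_mod_cast hQ
  have h1 : (Q : ℝ) * s < k := (Nat.floor_lt (by have := s.2.1; positivity)).1 h
  rw [lt_div_iff₀ hQ']
  linarith

/-- If dart `k` comes before the current dart at time `t`, then `(k + 1) / Q ≤ t`. [folklore] -/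
theorem div_le_of_lt_uIdx {Q : ℕ} (hQ : 0 < Q) {t : I} {k : ℕ} (h : k < uIdx[Q, t]) : ((k : ℝ) + 1) / Q ≤ t := by
  have hQ' : (0 : ℝ) < Q := by exact_mod_cast hQ
  have h1 : ((k + 1 : ℕ) : ℝ) ≤ (Q : ℝ) * t := (Nat.le_floor_iff (by have := t.2.1; positivity)).1 h
  push_cast at h1
  rw [div_le_iff₀ hQ']
  linarith

/-- **Every intermediate dart is current at an intermediate time.** [folklore] -/
theorem exists_time_of_uIdx {Q : ℕ} (hQ : 0 < Q) {s t : I} (hst : s ≤ t) {k : ℕ} (h1 : uIdx[Q, s] ≤ k)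
    (h2 : k ≤ uIdx[Q, t]) : ∃ u : I, s ≤ u ∧ u ≤ t ∧ uIdx[Q, u] = k := by
  have hQ' : (0 : ℝ) < Q := by exact_mod_cast hQ
  rcases eq_or_lt_of_le h1 with h | h
  · exact ⟨s, le_rfl, hst, h⟩
  · -- the time `k / Q`
    have hk : (s : ℝ) < k / Q := lt_div_of_uIdx_lt hQ h
    have hk' : (k : ℝ) / Q ≤ t := by
      have : (k : ℝ) ≤ (Q : ℝ) * t := (Nat.le_floor_iff (by have := t.2.1; positivity)).1 h2
      rw [div_le_iff₀ hQ']; linarith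
    have hmem : (k : ℝ) / Q ∈ Icc (0 : ℝ) 1 := ⟨by linarith [s.2.1], hk'.trans t.2.2⟩
    refine ⟨⟨(k : ℝ) / Q, hmem⟩, hk.le, hk', ?_⟩
    change ⌊(Q : ℝ) * ((k : ℝ) / Q)⌋₊ = k
    rw [mul_div_cancel₀ _ hQ'.ne', Nat.floor_natCast]

/-- A time in the first half of the slot of dart `m` has current dart `m`. [folklore] -/
theorem uIdx_eq_of_mem_slot {Q : ℕ} (hQ : 0 < Q) {u : I} {m : ℕ} (h1 : (m : ℝ) / Q ≤ u)
    (h2 : (u : ℝ) ≤ ((m : ℝ) + 1 / 2) / Q) : uIdx[Q, u] = m := by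
  have hQ' : (0 : ℝ) < Q := by exact_mod_cast hQ
  rw [div_le_iff₀ hQ'] at h1
  rw [le_div_iff₀ hQ'] at h2
  change ⌊(Q : ℝ) * u⌋₊ = m
  rw [Nat.floor_eq_iff (by have := u.2.1; positivity)]
  constructor <;> linarith

/-! ### The rounded loop stays near the vertex of its current dart -/

variable {β : BondConfig (Site 2)} {p : Site 2 × Fin 4} {δ : ℝ}

/-- The vertices of the orbit are periodic with the period. [folklore] -/
theorem cv_period (β : BondConfig (Site 2)) (p : Site 2 × Fin 4) :
    OrbitPolygon.cv β p (minimalPeriod (nextCorner β) p) = OrbitPolygon.cv β p 0 := by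
  rw [OrbitPolygon.cv, OrbitPolygon.cv, ← OrbitPolygon.corner_mod (minimalPeriod (nextCorner β) p), Nat.mod_self]

/-- The floor identity `⌊2Q t⌋ / 2 = ⌊Q t⌋`. [folklore] -/
theorem floor_two_mul_div_two (Q : ℕ) (t : ℝ) :
    ⌊((2 * Q : ℕ) : ℝ) * t⌋₊ / 2 = ⌊(Q : ℝ) * t⌋₊ := by
  rw [← Nat.floor_div_ofNat]
  congr 1
  push_cast
  ring

/-- **The rounded loop is within `3δ` of the vertex of its current dart**, at every time of `[0, 1]`.
[folklore] -/
theorem dist_roundedCurve_meshPoint_le (hp : p ∈ periodicPts (nextCorner β)) (hδ : 0 ≤ δ) (t : I) :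
    dist (RC[β, p, δ] t)
      (meshPoint δ (OrbitPolygon.cv β p (uIdx[minimalPeriod (nextCorner β) p, t]))) ≤ 3 * δ := by
  have _hQ : 0 < minimalPeriod (nextCorner β) p := minimalPeriod_pos_of_mem_periodicPts hp
  by_cases ht : (t : ℝ) < 1
  · have h := OrbitPolygon.dist_loop_meshPoint_le (β := β) (p := p) hδ (t := t) ⟨t.2.1, ht⟩
    rw [floor_two_mul_div_two] at h
    exact h
  · have ht1 : (t : ℝ) = 1 := le_antisymm t.2.2 (not_lt.1 ht)
    have hidx : uIdx[minimalPeriod (nextCorner β) p, t] = minimalPeriod (nextCorner β) p := by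
      rw [ht1, mul_one, Nat.floor_natCast]
    have hval : RC[β, p, δ] t = OrbitPolygon.loop β p δ 0 := by
      rw [roundedCurve_apply, ht1]
      have := OrbitPolygon.periodic_loop (β := β) (p := p) δ 0
      rwa [zero_add] at this
    rw [hidx, hval, cv_period]
    have h := OrbitPolygon.dist_loop_meshPoint_le (β := β) (p := p) hδ (t := 0) ⟨le_rfl, zero_lt_one⟩
    simpa using h

/-- **Two times with the same current dart are within `6δ`.** [folklore] -/
theorem dist_roundedCurve_le_of_uIdx_eq (hp : p ∈ periodicPts (nextCorner β)) (hδ : 0 ≤ δ) {u v : I}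
    (h : uIdx[minimalPeriod (nextCorner β) p, u] = uIdx[minimalPeriod (nextCorner β) p, v]) :
    dist (RC[β, p, δ] u) (RC[β, p, δ] v) ≤ 6 * δ := by
  have h1 := dist_roundedCurve_meshPoint_le hp hδ u
  have h2 := dist_roundedCurve_meshPoint_le hp hδ v
  rw [h] at h1
  linarith [dist_triangle_right (RC[β, p, δ] u) (RC[β, p, δ] v)
    (meshPoint δ (OrbitPolygon.cv β p (uIdx[minimalPeriod (nextCorner β) p, v])))]

/-- **Times with different current darts**: if the rounded loop is at radial distances more than `6δ`
apart at two times, their current darts differ. [folklore] -/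
theorem uIdx_ne_of_dist (hp : p ∈ periodicPts (nextCorner β)) (hδ : 0 ≤ δ) {x : ℂ} {u v : I}
    (h : 6 * δ < |dist (RC[β, p, δ] u) x - dist (RC[β, p, δ] v) x|) :
    uIdx[minimalPeriod (nextCorner β) p, u] ≠ uIdx[minimalPeriod (nextCorner β) p, v] := by
  intro heq
  have h1 := dist_roundedCurve_le_of_uIdx_eq hp hδ heq
  have h2 := abs_dist_sub_le (RC[β, p, δ] u) (RC[β, p, δ] v) x
  linarith

/-! ### Simplicity before time `1`, and the time of a point of a dart piece -/

/-- **The rounded curve is injective before time `1`.** [cite: CamiaNewman2006, §2] -/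
theorem roundedCurve_injOn (hp : p ∈ periodicPts (nextCorner β)) (hδ : 0 < δ) :
    InjOn RC[β, p, δ] {t : I | (t : ℝ) < 1} := by
  intro s hs t ht hst
  have := OrbitPolygon.injOn_loop hp hδ ⟨s.2.1, hs⟩ ⟨t.2.1, ht⟩ hst
  exact Subtype.ext this

/-- **The time of a point of a dart piece.** A point of the `m`-th dart piece (`m < Q`) is the value of
the rounded curve at a time `u` of the first half `[m/Q, (m + 1/2)/Q]` of the slot of dart `m`; in
particular the current dart at `u` is `m` and `u < 1`. [folklore] -/
theorem exists_time_of_mem_dartPiece (hp : p ∈ periodicPts (nextCorner β)) {m : ℕ}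
    (hm : m < minimalPeriod (nextCorner β) p) {z : ℂ} (hz : z ∈ OrbitPolygon.dartPiece β p δ m) :
    ∃ u : I, (m : ℝ) / minimalPeriod (nextCorner β) p ≤ u ∧
      (u : ℝ) ≤ ((m : ℝ) + 1 / 2) / minimalPeriod (nextCorner β) p ∧ (u : ℝ) < 1 ∧
      uIdx[minimalPeriod (nextCorner β) p, u] = m ∧ RC[β, p, δ] u = z := by
  set Q := minimalPeriod (nextCorner β) p with hQ
  have hQpos : 0 < Q := minimalPeriod_pos_of_mem_periodicPts hp
  have hQ' : (0 : ℝ) < Q := by exact_mod_cast hQpos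
  have hz' : z ∈ OrbitPolygon.piece β p δ (2 * m) := by
    rw [OrbitPolygon.piece, OrbitPolygon.segment_vtx_even]; exact hz
  obtain ⟨t, ht1, ht2, ht3, ht4, hval⟩ := OrbitPolygon.exists_time_of_mem_piece hp δ (m := 2 * m) (by omega) hz'
  have e1 : ((2 * m : ℕ) : ℝ) / ((2 * Q : ℕ) : ℝ) = (m : ℝ) / Q := by
    push_cast
    field_simp
  have e2 : (((2 * m : ℕ) : ℝ) + 1) / ((2 * Q : ℕ) : ℝ) = ((m : ℝ) + 1 / 2) / Q := by
    push_cast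
    field_simp
  rw [e1] at ht1
  rw [e2] at ht2
  have hlt : t < 1 := by
    refine lt_of_le_of_lt ht2 ?_
    rw [div_lt_one hQ']
    have : (m : ℝ) + 1 ≤ Q := by exact_mod_cast hm
    linarith
  refine ⟨⟨t, ht4, ht3⟩, ht1, ht2, hlt, uIdx_eq_of_mem_slot hQpos ht1 ht2, hval⟩

end BondLoopH1

/-- **Registered anchor** (`bondLoopH1_hasTraversals_roundedLoop`): `k` traversals of `D(x; ρ, R)` by
the medial polygon of an interface loop force `k` traversals of `D(x; ρ + 5δ, R - 5δ)` by the rounded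
Jordan loop of the orbit of its first corner. [cite: AizenmanBurchardDuke1999, §1 (1.3)] -/
theorem bondLoopH1_hasTraversals_roundedLoop : ∀ (β : BondConfig (Site 2)) (γ : List MedialVertex)
    (h : IsInterfaceLoop β γ) (p : Site 2 × Fin 4), cSrc p = γ[0 % γ.length]'(Nat.mod_lt _ h.length_pos) →
    cTgt p = γ[(0 + 1) % γ.length]'(Nat.mod_lt _ h.length_pos) → ∀ (δ : ℝ), 0 < δ →
    ∀ (k : ℕ) (x : ℂ) (ρ R : ℝ),
    (⟨polyline ((γ ++ γ.take 1).map (medialPoint δ))⟩ : Curve ℂ).HasTraversals k x ρ R →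
    (Curve.ofPeriodic (OrbitPolygon.loop β p δ) OrbitPolygon.continuous_loop).HasTraversals k x
      (ρ + 5 * δ) (R - 5 * δ) :=
  fun _ _ h _ hps hpt _ hδ _ _ _ _ htr ↦ BondLoopH1.hasTraversals_roundedCurve h hps hpt hδ htr

end Summit.CriticalPhenomena.CardyFormulaZ2.Cruxes.NestingRigidity.PositiveConeWeightDoubling

end
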